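import Summits.QuantumFields.YangMills.Theses.F4SubCurvatureDoor
import HarnessLib
import HarnessLib.Audit.Tags

/-!
# Route F4SubCurvatureDoor — Assembly (item stmt-QuantumFields-23038)

The assembly item of route `F4SubCurvatureDoor` is the implication chain
`TrialityLimit → SubCurvatureKernel → ShortRootRigidity → NPointStepF4 → BalabanLadder.ROT`,
which is exactly the curried form of the route file's planner-certified deciding theorem
`Summit.QuantumFields.YangMills.Theses.F4SubCurvatureDoor.closes` (King's door
`Theorems.ROT.rot_of_kingLimit`). [cite: King1986]
-/

namespace Summit.QuantumFields.YangMills.Theorems.F4SubCurvatureDoor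

/-- **Assembly of route F4SubCurvatureDoor** (item stmt-QuantumFields-23038), BY NAME: the four route items imply the
rung `BalabanLadder.ROT`, by the route file's deciding theorem `Theses.F4SubCurvatureDoor.closes`. [cite: King1986] -/
theorem assembly_proof : Summit.QuantumFields.YangMills.Theses.F4SubCurvatureDoor.Assembly := by
  unfold Summit.QuantumFields.YangMills.Theses.F4SubCurvatureDoor.Assembly
  exact fun hT hK hR hN => Summit.QuantumFields.YangMills.Theses.F4SubCurvatureDoor.closes hT hK hR hN

end Summit.QuantumFields.YangMills.Theorems.F4SubCurvatureDoor
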